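import Literature.Analysis.FunctionSpaces.RegularizedDistance
import Mathlib.Analysis.SpecialFunctions.SmoothTransition
import Mathlib.Analysis.Calculus.ContDiff.Bounds
import HarnessLib

/-!
# A dyadic partition of unity off a closed set, with derivative bounds

Support file 2/7 for the planned proof of `Literature.Analysis.Calculus.WhitneyExtensionConvex`
(`WhitneyExtension.lean`; Whitney (1934), Thm. I, on closed convex sets with nonempty interior)
by a Seeley-type dilation–extrapolation operator.  Off a closed set `K` of a
finite-dimensional real normed space `E` we build the smooth dyadic layer functions

`Λ_k(x) = θ(2^k Δ(x) / ρ)`, `θ(s) = χ(s) - χ(2s)`, `χ(s) = smoothTransition (2 - s)`,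

where `Δ` is the regularized distance of Stein (*Singular integrals* (1970), Ch. VI, §2.1,
Thm. 2) for the distance function `d = infDist · K`, as proved in the tree for any Lipschitz
function (`Literature.Analysis.FunctionSpaces.exists_regularizedDistance`,
`RegularizedDistance.lean`: `Δ` smooth on `{d > 0}`, `d ≤ Δ ≤ 8 d`,
`|∂_β Δ| d^{|β|-1} ≤ B_{|β|} ∏ ‖vᵢ‖`), and `ρ > 0` is a base scale.  The point of the telescoping
choice `θ(s) = χ(s) - χ(2s)` is that **no normalization is needed**:
`∑_{k<N} Λ_k = χ(Δ/ρ) - χ(2^N Δ/ρ)`, so near `K` the layers sum to the smooth near-field dyadicCutoff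
`χ(Δ/ρ)` (Whitney's partition of unity by cubes, Whitney (1934) §§8–10 / Stein Ch. VI §1.3, is
replaced by layers of the regularized distance; the dilation–extrapolation operator needs
resolution in the distance variable only).

* `Literature.Analysis.Calculus.WhitneyConvex.dyadicCutoff`, `dyadicBump` — `χ`, `θ`: smoothness, values
  in `[0, 1]`, `θ = 0` off `(1/2, 2)`, the telescoping identity `sum_range_dyadicBump`, and
  bounds `dyadicBumpBound i` for all derivatives of `θ`;
* `Literature.Analysis.Calculus.WhitneyConvex.iterDirDeriv_ofFn_eq_iteratedFDeriv` — the
  tree's iterated directional derivatives (`Literature.Analysis.FunctionSpaces.iterDirDeriv`)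
  are the values of `iteratedFDeriv` for functions smooth on an *open set* (the tree's
  `iterDirDeriv_eq_iteratedFDeriv` assumes global smoothness);
* `Literature.Analysis.Calculus.WhitneyConvex.regDist K` — a regularized distance for `K`
  (chosen by `exists_regularizedDistance`, Lipschitz constant `1`), with
  `norm_iteratedFDeriv_regDist_le`: `‖Dⁱ Δ(z)‖ ≤ R_i / d(z)^{i-1}` in operator norm;
* `Literature.Analysis.Calculus.WhitneyConvex.layer K ρ k` — the layer functions: smooth on
  `{d > 0}`, values in `[0, 1]`, supported where `ρ 2^{-k}/16 < d < 2ρ 2^{-k}`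
  (`infDist_lt_of_layer_ne_zero`, `lt_infDist_of_layer_ne_zero`), summing to `χ(Δ/ρ)`
  (`sum_range_layer`), locally finitely many near each point of `{d > 0}`
  (`eventually_layer_eq_zero`), and — the main point — with **scale-invariant derivative
  bounds** `‖Dⁱ Λ_k(x)‖ ≤ C_i (2^k/ρ)^i` (`norm_iteratedFDeriv_layer_le`, Mathlib's
  `norm_iteratedFDerivWithin_comp_le`).

## References

* E. M. Stein, *Singular Integrals and Differentiability Properties of Functions* (1970),
  Ch. VI, §1.3 (partition of unity for a Whitney decomposition), §2.1 Thm. 2 (regularized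
  distance). [SteinSingularIntegrals1970]
* H. Whitney, *Analytic extensions of differentiable functions defined in closed sets*, Trans.
  Amer. Math. Soc. 36 (1934), 63–89, §§8–10. [Whitney1934]
-/

open Set Metric Filter Function Finset
open scoped ContDiff Topology NNReal Nat
open Literature.Analysis.FunctionSpaces (iterDirDeriv iterDirDeriv_cons iterDirDeriv_nil
  eventuallyEq_iterDirDeriv exists_regularizedDistance)

noncomputable section

namespace Literature.Analysis.Calculus.WhitneyConvex

/-! ### The dyadicCutoff `χ` and the dyadic bump `θ` -/

section Cutoff

/-- The dyadicCutoff `χ(s) = smoothTransition (2 - s)`: smooth, antitone, `χ = 1` on `(-∞, 1]`,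
`χ = 0` on `[2, ∞)`. [folklore] -/
def dyadicCutoff (s : ℝ) : ℝ := Real.smoothTransition (2 - s)

/-- `χ = 1` on `(-∞, 1]`. [folklore] -/
theorem dyadicCutoff_of_le_one {s : ℝ} (hs : s ≤ 1) : dyadicCutoff s = 1 :=
  Real.smoothTransition.one_of_one_le (by linarith)

/-- `χ = 0` on `[2, ∞)`. [folklore] -/
theorem dyadicCutoff_of_two_le {s : ℝ} (hs : 2 ≤ s) : dyadicCutoff s = 0 :=
  Real.smoothTransition.zero_of_nonpos (by linarith)

/-- `χ` is smooth. [folklore] -/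
theorem contDiff_dyadicCutoff {n : ℕ∞} : ContDiff ℝ n dyadicCutoff :=
  Real.smoothTransition.contDiff.comp (contDiff_const.sub contDiff_id)

/-- `0 ≤ χ`. [folklore] -/
theorem dyadicCutoff_nonneg (s : ℝ) : 0 ≤ dyadicCutoff s := Real.smoothTransition.nonneg _

/-- `χ ≤ 1`. [folklore] -/
theorem dyadicCutoff_le_one (s : ℝ) : dyadicCutoff s ≤ 1 := Real.smoothTransition.le_one _

/-- `χ` is antitone. [folklore] -/
theorem dyadicCutoff_antitone : Antitone dyadicCutoff := fun _ _ h =>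
  Real.smoothTransition.monotone (by linarith)

/-- The **dyadic bump** `θ(s) = χ(s) - χ(2s)`, supported in `[1/2, 2]`. [folklore] -/
def dyadicBump (s : ℝ) : ℝ := dyadicCutoff s - dyadicCutoff (2 * s)

/-- Unfolding `θ`. [folklore] -/
theorem dyadicBump_apply (s : ℝ) : dyadicBump s = dyadicCutoff s - dyadicCutoff (2 * s) := rfl

/-- `θ` is smooth. [folklore] -/
theorem contDiff_dyadicBump {n : ℕ∞} : ContDiff ℝ n dyadicBump :=
  contDiff_dyadicCutoff.sub (contDiff_dyadicCutoff.comp (contDiff_const.mul contDiff_id))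

/-- `0 ≤ θ`. [folklore] -/
theorem dyadicBump_nonneg (s : ℝ) : 0 ≤ dyadicBump s := by
  rw [dyadicBump_apply, sub_nonneg]
  rcases le_or_gt 0 s with hs | hs
  · exact dyadicCutoff_antitone (by linarith)
  · rw [dyadicCutoff_of_le_one (by linarith), dyadicCutoff_of_le_one (by linarith)]

/-- `θ ≤ 1`. [folklore] -/
theorem dyadicBump_le_one (s : ℝ) : dyadicBump s ≤ 1 := by
  rw [dyadicBump_apply]
  linarith [dyadicCutoff_le_one s, dyadicCutoff_nonneg (2 * s)]

/-- `θ = 0` on `(-∞, 1/2]`. [folklore] -/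
theorem dyadicBump_of_le_half {s : ℝ} (hs : s ≤ 1 / 2) : dyadicBump s = 0 := by
  rw [dyadicBump_apply, dyadicCutoff_of_le_one (by linarith), dyadicCutoff_of_le_one (by linarith), sub_self]

/-- `θ = 0` on `[2, ∞)`. [folklore] -/
theorem dyadicBump_of_two_le {s : ℝ} (hs : 2 ≤ s) : dyadicBump s = 0 := by
  rw [dyadicBump_apply, dyadicCutoff_of_two_le hs, dyadicCutoff_of_two_le (by linarith), sub_self]

/-- If `θ s ≠ 0` then `1/2 < s < 2`. [folklore] -/
theorem mem_Ioo_of_dyadicBump_ne_zero {s : ℝ} (hs : dyadicBump s ≠ 0) : s ∈ Set.Ioo (1 / 2) 2 :=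
  ⟨lt_of_not_ge fun h => hs (dyadicBump_of_le_half h),
    lt_of_not_ge fun h => hs (dyadicBump_of_two_le h)⟩

/-- **The telescoping identity** `∑_{k<N} θ(2^k s) = χ(s) - χ(2^N s)`. [folklore] -/
theorem sum_range_dyadicBump (s : ℝ) (N : ℕ) :
    ∑ k ∈ range N, dyadicBump (2 ^ k * s) = dyadicCutoff s - dyadicCutoff (2 ^ N * s) := by
  induction N with
  | zero => simp
  | succ N ih =>
    rw [sum_range_succ, ih, dyadicBump_apply, pow_succ]
    ring_nf

/-- Beyond the last active layer the dyadic bumps sum to the dyadicCutoff: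
`∑_{k<N} θ(2^k s) = χ(s)` once `2^N s ≥ 2`. [folklore] -/
theorem sum_range_dyadicBump_of_le {s : ℝ} {N : ℕ} (h : 2 ≤ 2 ^ N * s) :
    ∑ k ∈ range N, dyadicBump (2 ^ k * s) = dyadicCutoff s := by
  rw [sum_range_dyadicBump, dyadicCutoff_of_two_le h, sub_zero]

/-- The derivatives of `θ` are bounded (it is constant off the compact `[1/2, 2]`).
[folklore] -/
theorem exists_bound_iteratedFDeriv_dyadicBump (i : ℕ) :
    ∃ C : ℝ, 0 ≤ C ∧ ∀ s, ‖iteratedFDeriv ℝ i dyadicBump s‖ ≤ C := by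
  have hcd : ContDiff ℝ ∞ dyadicBump := contDiff_dyadicBump
  have hc : Continuous fun s => ‖iteratedFDeriv ℝ i dyadicBump s‖ :=
    (hcd.continuous_iteratedFDeriv (by exact_mod_cast le_top)).norm
  obtain ⟨C, hC⟩ := (isCompact_Icc (a := (1 / 4 : ℝ)) (b := 4)).exists_bound_of_continuousOn
    hc.continuousOn
  refine ⟨max C 1, le_max_of_le_right zero_le_one, fun s => ?_⟩
  by_cases hs : s ∈ Set.Icc (1 / 4 : ℝ) 4
  · have h1 := hC s hs
    rw [Real.norm_of_nonneg (norm_nonneg _)] at h1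
    exact h1.trans (le_max_left _ _)
  · -- near `s` the bump vanishes identically
    have hconst : dyadicBump =ᶠ[𝓝 s] fun _ => (0 : ℝ) := by
      rcases not_and_or.1 hs with h | h
      · have h' : s < 1 / 4 := lt_of_not_ge h
        filter_upwards [Iio_mem_nhds (show s < 1 / 2 by linarith)] with y hy
        exact dyadicBump_of_le_half (le_of_lt hy)
      · have h' : 4 < s := lt_of_not_ge h
        filter_upwards [Ioi_mem_nhds (show 2 < s by linarith)] with y hy
        exact dyadicBump_of_two_le (le_of_lt hy)
    have h1 : iteratedFDeriv ℝ i dyadicBump s = iteratedFDeriv ℝ i (fun _ : ℝ => (0 : ℝ)) s :=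
      (hconst.iteratedFDeriv ℝ i).eq_of_nhds
    rw [h1, iteratedFDeriv_fun_zero, Pi.zero_apply, norm_zero]
    exact le_trans zero_le_one (le_max_right _ _)

/-- A fixed bound for the `i`-th derivative of `θ`. [folklore] -/
def dyadicBumpBound (i : ℕ) : ℝ := Classical.choose (exists_bound_iteratedFDeriv_dyadicBump i)

/-- The bounds are nonnegative. [folklore] -/
theorem dyadicBumpBound_nonneg (i : ℕ) : 0 ≤ dyadicBumpBound i :=
  (Classical.choose_spec (exists_bound_iteratedFDeriv_dyadicBump i)).1

/-- `‖Dⁱ θ‖ ≤ dyadicBumpBound i`. [folklore] -/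
theorem norm_iteratedFDeriv_dyadicBump_le (i : ℕ) (s : ℝ) :
    ‖iteratedFDeriv ℝ i dyadicBump s‖ ≤ dyadicBumpBound i :=
  (Classical.choose_spec (exists_bound_iteratedFDeriv_dyadicBump i)).2 s

/-- A bound for all derivatives of `θ` of order `≤ i` at once: `∑_{l ≤ i} dyadicBumpBound l`.
[folklore] -/
def dyadicBumpBound' (i : ℕ) : ℝ := ∑ l ∈ range (i + 1), dyadicBumpBound l

/-- The cumulative bounds are nonnegative. [folklore] -/
theorem dyadicBumpBound'_nonneg (i : ℕ) : 0 ≤ dyadicBumpBound' i :=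
  sum_nonneg fun l _ => dyadicBumpBound_nonneg l

/-- `‖Dˡ θ‖ ≤ dyadicBumpBound' i` for `l ≤ i`. [folklore] -/
theorem norm_iteratedFDeriv_dyadicBump_le' {l i : ℕ} (hl : l ≤ i) (s : ℝ) :
    ‖iteratedFDeriv ℝ l dyadicBump s‖ ≤ dyadicBumpBound' i :=
  (norm_iteratedFDeriv_dyadicBump_le l s).trans
    (single_le_sum (f := dyadicBumpBound) (fun l _ => dyadicBumpBound_nonneg l)
      (mem_range.2 (Nat.lt_succ_of_le hl)))

end Cutoff

/-! ### Iterated directional derivatives of functions smooth on an open set -/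

section DirDeriv

variable {E : Type*} [NormedAddCommGroup E] [NormedSpace ℝ E]
variable {F : Type*} [NormedAddCommGroup F] [NormedSpace ℝ F]

/-- **Iterated directional derivatives are values of the iterated Fréchet derivative**, for a
function smooth on an open set (the tree's `iterDirDeriv_eq_iteratedFDeriv` localized):
`∂_{v₀} ⋯ ∂_{v_{i-1}} f (x) = Dⁱ f(x)(v₀, …, v_{i-1})` at points of the open set. [folklore] -/
theorem iterDirDeriv_ofFn_eq_iteratedFDeriv {f : E → F} {U : Set E} (hU : IsOpen U)
    (hf : ContDiffOn ℝ ∞ f U) :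
    ∀ {i : ℕ} (v : Fin i → E) {x : E}, x ∈ U →
      iterDirDeriv (List.ofFn v) f x = iteratedFDeriv ℝ i f x v
  | 0, v, x, _ => by
    rw [List.ofFn_zero, iterDirDeriv_nil, iteratedFDeriv_zero_apply]
  | i + 1, v, x, hx => by
    rw [List.ofFn_succ, iterDirDeriv_cons]
    -- the inner directional derivative agrees near `x` with the value of `Dⁱ f`
    have heq : iterDirDeriv (List.ofFn fun j : Fin i => v j.succ) f =ᶠ[𝓝 x]
        fun y => iteratedFDeriv ℝ i f y fun j => v j.succ := by
      filter_upwards [hU.mem_nhds hx] with y hy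
      exact iterDirDeriv_ofFn_eq_iteratedFDeriv hU hf (fun j => v j.succ) hy
    show fderiv ℝ (iterDirDeriv (List.ofFn fun j : Fin i => v j.succ) f) x (v 0) = _
    rw [heq.fderiv_eq]
    have hdiff : DifferentiableAt ℝ (iteratedFDeriv ℝ i f) x := by
      have h1 : DifferentiableOn ℝ (iteratedFDerivWithin ℝ i f U) U :=
        hf.differentiableOn_iteratedFDerivWithin (by exact_mod_cast WithTop.coe_lt_top _)
          hU.uniqueDiffOn
      have h2 : iteratedFDerivWithin ℝ i f U =ᶠ[𝓝 x] iteratedFDeriv ℝ i f := by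
        filter_upwards [hU.mem_nhds hx] with y hy
        exact iteratedFDerivWithin_of_isOpen i hU hy
      exact (h2.differentiableAt_iff).1 ((h1 x hx).differentiableAt (hU.mem_nhds hx))
    rw [fderiv_continuousMultilinear_apply_const_apply hdiff, iteratedFDeriv_succ_apply_left]
    rfl

/-- Operator-norm bound for `Dⁱ f(x)` from a bound on all iterated directional derivatives of
order `i` at `x` (for `f` smooth on an open set containing `x`). [folklore] -/
theorem norm_iteratedFDeriv_le_of_iterDirDeriv {f : E → F} {U : Set E} (hU : IsOpen U)
    (hf : ContDiffOn ℝ ∞ f U) {x : E} (hx : x ∈ U) {i : ℕ} {M : ℝ} (hM : 0 ≤ M)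
    (h : ∀ v : Fin i → E, ‖iterDirDeriv (List.ofFn v) f x‖ ≤ M * ∏ j, ‖v j‖) :
    ‖iteratedFDeriv ℝ i f x‖ ≤ M :=
  ContinuousMultilinearMap.opNorm_le_bound hM fun v => by
    rw [← iterDirDeriv_ofFn_eq_iteratedFDeriv hU hf v hx]
    exact h v

end DirDeriv

/-! ### The regularized distance of a closed set -/

section RegDist

variable {E : Type*} [NormedAddCommGroup E]

/-- The open set `{d > 0}` off `K` (equal to `Kᶜ` for closed nonempty `K`). [folklore] -/
def offSet (K : Set E) : Set E := {z | 0 < infDist z K}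

/-- Membership in `offSet`. [folklore] -/
theorem mem_offSet {K : Set E} {z : E} : z ∈ offSet K ↔ 0 < infDist z K := Iff.rfl

/-- `{d > 0}` is open. [folklore] -/
theorem isOpen_offSet (K : Set E) : IsOpen (offSet K) :=
  isOpen_lt continuous_const (continuous_infDist_pt K)

/-- For a closed nonempty set, `{d > 0}` is the complement. [folklore] -/
theorem offSet_eq_compl {K : Set E} (hK : IsClosed K) (hne : K.Nonempty) : offSet K = Kᶜ := by
  ext z
  rw [mem_offSet, mem_compl_iff, ← hK.notMem_iff_infDist_pos hne]

variable [NormedSpace ℝ E] [FiniteDimensional ℝ E] [MeasurableSpace E] [BorelSpace E]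

variable (E) in
/-- The constants `B_i` of the regularized distance for `1`-Lipschitz functions on `E`
(`exists_regularizedDistance`, Stein (1970), Ch. VI, §2.1, Thm. 2).
[cite: SteinSingularIntegrals1970, Ch. VI §2.1 Theorem 2] -/
def rdConst : ℕ → ℝ := Classical.choose (exists_regularizedDistance (E := E) 1)

variable (E) in
/-- The defining property of the constants `rdConst E`. [folklore] -/
theorem rdConst_spec : ∀ d : E → ℝ, LipschitzWith 1 d →
    ∃ Δ : E → ℝ, ContDiffOn ℝ ∞ Δ {z | 0 < d z} ∧
      (∀ z, 0 < d z → d z ≤ Δ z ∧ Δ z ≤ 8 * d z) ∧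
      ∀ (β : List E), β ≠ [] → ∀ z, 0 < d z →
        |iterDirDeriv β Δ z| * d z ^ (β.length - 1) ≤ rdConst E β.length * ∏ i, ‖β.get i‖ :=
  Classical.choose_spec (exists_regularizedDistance (E := E) 1)

/-- **A regularized distance for the set `K`**: Stein's `Δ` for the `1`-Lipschitz function
`d = infDist · K` (chosen by `exists_regularizedDistance`).
[cite: SteinSingularIntegrals1970, Ch. VI §2.1 Theorem 2] -/
def regDist (K : Set E) : E → ℝ :=
  Classical.choose (rdConst_spec E (fun x => infDist x K) (lipschitz_infDist_pt K))

/-- The three properties of the regularized distance. [folklore] -/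
theorem regDist_spec (K : Set E) :
    ContDiffOn ℝ ∞ (regDist K) (offSet K) ∧
      (∀ z, 0 < infDist z K → infDist z K ≤ regDist K z ∧ regDist K z ≤ 8 * infDist z K) ∧
      ∀ (β : List E), β ≠ [] → ∀ z, 0 < infDist z K →
        |iterDirDeriv β (regDist K) z| * infDist z K ^ (β.length - 1) ≤
          rdConst E β.length * ∏ i, ‖β.get i‖ :=
  Classical.choose_spec (rdConst_spec E (fun x => infDist x K) (lipschitz_infDist_pt K))

/-- `Δ` is smooth off `K`. [folklore] -/
theorem contDiffOn_regDist (K : Set E) : ContDiffOn ℝ ∞ (regDist K) (offSet K) :=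
  (regDist_spec K).1

/-- `d ≤ Δ` off `K`. [folklore] -/
theorem infDist_le_regDist {K : Set E} {z : E} (hz : 0 < infDist z K) :
    infDist z K ≤ regDist K z :=
  ((regDist_spec K).2.1 z hz).1

/-- `Δ ≤ 8 d` off `K`. [folklore] -/
theorem regDist_le {K : Set E} {z : E} (hz : 0 < infDist z K) :
    regDist K z ≤ 8 * infDist z K :=
  ((regDist_spec K).2.1 z hz).2

/-- `Δ > 0` off `K`. [folklore] -/
theorem regDist_pos {K : Set E} {z : E} (hz : 0 < infDist z K) : 0 < regDist K z :=
  hz.trans_le (infDist_le_regDist hz)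

/-- `Δ` is continuous at points off `K`. [folklore] -/
theorem continuousAt_regDist {K : Set E} {z : E} (hz : 0 < infDist z K) :
    ContinuousAt (regDist K) z :=
  ((contDiffOn_regDist K).continuousOn z hz).continuousAt ((isOpen_offSet K).mem_nhds hz)

/-- A nonnegative version of the constants. [folklore] -/
def rdConst' (E : Type*) [NormedAddCommGroup E] [NormedSpace ℝ E] [FiniteDimensional ℝ E]
    [MeasurableSpace E] [BorelSpace E] (i : ℕ) : ℝ :=
  max (rdConst E i) 0

/-- `rdConst'` is nonnegative. [folklore] -/
theorem rdConst'_nonneg (i : ℕ) : 0 ≤ rdConst' E i := le_max_right _ _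

/-- **Operator-norm bounds for the derivatives of the regularized distance**:
`‖Dⁱ Δ(z)‖ ≤ R_i / d(z)^{i-1}` for `i ≥ 1` and `z` off `K`. [folklore] -/
theorem norm_iteratedFDeriv_regDist_le {K : Set E} {i : ℕ} (hi : 1 ≤ i) {z : E}
    (hz : 0 < infDist z K) :
    ‖iteratedFDeriv ℝ i (regDist K) z‖ ≤ rdConst' E i / infDist z K ^ (i - 1) := by
  have hdpow : 0 < infDist z K ^ (i - 1) := pow_pos hz _
  refine norm_iteratedFDeriv_le_of_iterDirDeriv (isOpen_offSet K) (contDiffOn_regDist K) hz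
    (div_nonneg (rdConst'_nonneg i) hdpow.le) fun v => ?_
  have hne : List.ofFn v ≠ [] := by
    rw [Ne, List.ofFn_eq_nil_iff]; omega
  have h := (regDist_spec K).2.2 (List.ofFn v) hne z hz
  have hlen : (List.ofFn v).length = i := List.length_ofFn
  have hprod : (∏ j, ‖(List.ofFn v).get j‖) = ∏ j : Fin i, ‖v j‖ :=
    Fintype.prod_equiv (finCongr hlen) _ _ fun j => by
      rw [List.get_ofFn]
      exact congrArg (fun w : Fin i => ‖v w‖) (Fin.ext (by simp))
  rw [hprod, hlen] at h
  rw [Real.norm_eq_abs, div_mul_eq_mul_div, le_div_iff₀ hdpow]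
  calc |iterDirDeriv (List.ofFn v) (regDist K) z| * infDist z K ^ (i - 1)
      ≤ rdConst E i * ∏ j : Fin i, ‖v j‖ := h
    _ ≤ rdConst' E i * ∏ j : Fin i, ‖v j‖ :=
        mul_le_mul_of_nonneg_right (le_max_left _ _) (prod_nonneg fun _ _ => norm_nonneg _)

end RegDist

/-! ### The dyadic layers -/

section Layers

variable {E : Type*} [NormedAddCommGroup E] [NormedSpace ℝ E] [FiniteDimensional ℝ E]
  [MeasurableSpace E] [BorelSpace E]

/-- **The dyadic layer functions** `Λ_k(x) = θ(2^k Δ(x) / ρ)` of a set `K` at base scale `ρ`.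
[folklore] -/
def layer (K : Set E) (ρ : ℝ) (k : ℕ) (x : E) : ℝ := dyadicBump ((2 ^ k / ρ) * regDist K x)

/-- Unfolding the layers as a composition. [folklore] -/
theorem layer_eq_comp (K : Set E) (ρ : ℝ) (k : ℕ) :
    layer K ρ k = dyadicBump ∘ ((2 ^ k / ρ) • regDist K) := by
  funext x; rfl

/-- The layers are smooth off `K`. [folklore] -/
theorem contDiffOn_layer (K : Set E) (ρ : ℝ) (k : ℕ) : ContDiffOn ℝ ∞ (layer K ρ k) (offSet K) := by
  rw [layer_eq_comp]
  exact contDiff_dyadicBump.comp_contDiffOn (contDiffOn_const.smul (contDiffOn_regDist K))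

/-- `0 ≤ Λ_k`. [folklore] -/
theorem layer_nonneg (K : Set E) (ρ : ℝ) (k : ℕ) (x : E) : 0 ≤ layer K ρ k x := dyadicBump_nonneg _

/-- `Λ_k ≤ 1`. [folklore] -/
theorem layer_le_one (K : Set E) (ρ : ℝ) (k : ℕ) (x : E) : layer K ρ k x ≤ 1 := dyadicBump_le_one _

/-- Where `Λ_k ≠ 0`: `ρ/2 < 2^k Δ < 2ρ`. [folklore] -/
theorem regDist_mem_of_layer_ne_zero {K : Set E} {ρ : ℝ} (hρ : 0 < ρ) {k : ℕ} {x : E}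
    (hx : layer K ρ k x ≠ 0) : ρ / 2 < 2 ^ k * regDist K x ∧ 2 ^ k * regDist K x < 2 * ρ := by
  have h := mem_Ioo_of_dyadicBump_ne_zero hx
  rw [Set.mem_Ioo, div_mul_eq_mul_div, lt_div_iff₀ hρ, div_lt_iff₀ hρ] at h
  constructor <;> linarith [h.1, h.2]

/-- Where `Λ_k ≠ 0` (off `K`): `d < 2ρ/2^k`. [folklore] -/
theorem infDist_lt_of_layer_ne_zero {K : Set E} {ρ : ℝ} (hρ : 0 < ρ) {k : ℕ} {x : E}
    (hxK : 0 < infDist x K) (hx : layer K ρ k x ≠ 0) : infDist x K < 2 * ρ / 2 ^ k := by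
  have h := (regDist_mem_of_layer_ne_zero hρ hx).2
  have h2 : (0 : ℝ) < 2 ^ k := by positivity
  rw [lt_div_iff₀ h2]
  calc infDist x K * 2 ^ k ≤ regDist K x * 2 ^ k :=
        mul_le_mul_of_nonneg_right (infDist_le_regDist hxK) h2.le
    _ < 2 * ρ := by linarith

/-- Where `Λ_k ≠ 0` (off `K`): `ρ/(16 · 2^k) < d`. [folklore] -/
theorem lt_infDist_of_layer_ne_zero {K : Set E} {ρ : ℝ} (hρ : 0 < ρ) {k : ℕ} {x : E}
    (hxK : 0 < infDist x K) (hx : layer K ρ k x ≠ 0) : ρ / (16 * 2 ^ k) < infDist x K := by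
  have h := (regDist_mem_of_layer_ne_zero hρ hx).1
  have h2 : (0 : ℝ) < 2 ^ k := by positivity
  rw [div_lt_iff₀ (by positivity)]
  have h8 := regDist_le hxK
  nlinarith

/-- **The layers sum to the near-field dyadicCutoff**: `∑_{k<N} Λ_k(x) = χ(Δ(x)/ρ)` as soon as
`2^N Δ(x) ≥ 2ρ` (telescoping). [folklore] -/
theorem sum_range_layer {K : Set E} {ρ : ℝ} (hρ : 0 < ρ) {N : ℕ} {x : E}
    (hN : 2 * ρ ≤ 2 ^ N * regDist K x) :
    ∑ k ∈ range N, layer K ρ k x = dyadicCutoff (regDist K x / ρ) := by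
  have h : ∀ k : ℕ, layer K ρ k x = dyadicBump (2 ^ k * (regDist K x / ρ)) := fun k => by
    rw [layer]; ring_nf
  simp_rw [h]
  refine sum_range_dyadicBump_of_le ?_
  rw [← mul_div_assoc, le_div_iff₀ hρ]
  linarith

/-- The general partial sums: `∑_{k<N} Λ_k(x) = χ(Δ(x)/ρ) - χ(2^N Δ(x)/ρ)`. [folklore] -/
theorem sum_range_layer_eq {K : Set E} (ρ : ℝ) (N : ℕ) (x : E) :
    ∑ k ∈ range N, layer K ρ k x = dyadicCutoff (regDist K x / ρ) - dyadicCutoff (2 ^ N * (regDist K x / ρ)) := by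
  have h : ∀ k : ℕ, layer K ρ k x = dyadicBump (2 ^ k * (regDist K x / ρ)) := fun k => by
    rw [layer]; ring_nf
  simp_rw [h]
  exact sum_range_dyadicBump _ _

/-- Partial sums of the layers lie in `[0, 1]`. [folklore] -/
theorem sum_range_layer_mem_Icc (K : Set E) (ρ : ℝ) (N : ℕ) (x : E) :
    ∑ k ∈ range N, layer K ρ k x ∈ Set.Icc (0 : ℝ) 1 := by
  refine ⟨sum_nonneg fun k _ => layer_nonneg K ρ k x, ?_⟩
  rw [sum_range_layer_eq]
  have h1 := dyadicCutoff_le_one (regDist K x / ρ)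
  have h2 := dyadicCutoff_nonneg (2 ^ N * (regDist K x / ρ))
  linarith

/-- **Local finiteness**: near a point off `K` only finitely many layers are active — if
`2^N Δ(x₀) ≥ 4ρ` then `Λ_k = 0` near `x₀` for all `k ≥ N`. [folklore] -/
theorem eventually_layer_eq_zero {K : Set E} {ρ : ℝ} (hρ : 0 < ρ) {x₀ : E}
    (hx₀ : 0 < infDist x₀ K) {N : ℕ} (hN : 4 * ρ ≤ 2 ^ N * regDist K x₀) :
    ∀ᶠ x in 𝓝 x₀, ∀ k, N ≤ k → layer K ρ k x = 0 := by
  have hΔ₀ : 0 < regDist K x₀ := regDist_pos hx₀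
  have hev : ∀ᶠ x in 𝓝 x₀, regDist K x₀ / 2 < regDist K x :=
    (continuousAt_regDist hx₀).eventually (lt_mem_nhds (by linarith))
  filter_upwards [hev] with x hx k hk
  by_contra hne
  have h := (regDist_mem_of_layer_ne_zero hρ hne).2
  have hk' : (2 : ℝ) ^ N ≤ 2 ^ k := pow_le_pow_right₀ (by norm_num) hk
  have h0 : 0 ≤ regDist K x := by linarith
  nlinarith [mul_le_mul_of_nonneg_right hk' h0]

/-- For every point off `K` there is such an `N`. [folklore] -/
theorem exists_pow_mul_regDist_ge {K : Set E} (ρ : ℝ) {x₀ : E}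
    (hx₀ : 0 < infDist x₀ K) (c : ℝ) : ∃ N : ℕ, c * ρ ≤ 2 ^ N * regDist K x₀ := by
  have hΔ₀ : 0 < regDist K x₀ := regDist_pos hx₀
  obtain ⟨N, hN⟩ := pow_unbounded_of_one_lt (c * ρ / regDist K x₀) (by norm_num : (1 : ℝ) < 2)
  exact ⟨N, by rw [div_lt_iff₀ hΔ₀] at hN; exact hN.le⟩

/-- Near a point off `K`, the full layer sum is a fixed finite sum, equal to the near-field
dyadicCutoff: if `2^N Δ(x₀) ≥ 4ρ` then `∑_{k<N} Λ_k = χ(Δ/ρ)` near `x₀`, and the same for every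
`N' ≥ N`. [folklore] -/
theorem eventually_sum_range_layer {K : Set E} {ρ : ℝ} (hρ : 0 < ρ) {x₀ : E}
    (hx₀ : 0 < infDist x₀ K) {N : ℕ} (hN : 4 * ρ ≤ 2 ^ N * regDist K x₀) :
    ∀ᶠ x in 𝓝 x₀, ∀ N', N ≤ N' → ∑ k ∈ range N', layer K ρ k x = dyadicCutoff (regDist K x / ρ) := by
  have hΔ₀ : 0 < regDist K x₀ := regDist_pos hx₀
  have hev : ∀ᶠ x in 𝓝 x₀, regDist K x₀ / 2 < regDist K x :=
    (continuousAt_regDist hx₀).eventually (lt_mem_nhds (by linarith))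
  filter_upwards [hev] with x hx N' hN'
  refine sum_range_layer hρ ?_
  have hk' : (2 : ℝ) ^ N ≤ 2 ^ N' := pow_le_pow_right₀ (by norm_num) hN'
  have h0 : 0 ≤ regDist K x := by linarith
  nlinarith [mul_le_mul_of_nonneg_right hk' h0]

/-! ### Derivative bounds for the layers -/

/-- A bound `R*_i ≥ 1` dominating the regularized-distance constants `R_l`, `l ≤ i`.
[folklore] -/
def rdConstMax (E : Type*) [NormedAddCommGroup E] [NormedSpace ℝ E] [FiniteDimensional ℝ E]
    [MeasurableSpace E] [BorelSpace E] (i : ℕ) : ℝ :=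
  max 1 (∑ l ∈ range (i + 1), rdConst' E l)

/-- `1 ≤ R*_i`. [folklore] -/
theorem one_le_rdConstMax (i : ℕ) : 1 ≤ rdConstMax E i := le_max_left _ _

/-- `R_l ≤ R*_i` for `l ≤ i`. [folklore] -/
theorem rdConst'_le_rdConstMax {l i : ℕ} (hl : l ≤ i) : rdConst' E l ≤ rdConstMax E i :=
  (single_le_sum (f := rdConst' E) (fun l _ => rdConst'_nonneg l)
    (mem_range.2 (Nat.lt_succ_of_le hl))).trans (le_max_right _ _)

/-- **The constant** `C_i = i! · Θ_i · (16 R*_i)^i` of the derivative bounds for the layers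
(depends only on `E` and `i`). [folklore] -/
def layerBound (E : Type*) [NormedAddCommGroup E] [NormedSpace ℝ E] [FiniteDimensional ℝ E]
    [MeasurableSpace E] [BorelSpace E] (i : ℕ) : ℝ :=
  i ! * dyadicBumpBound' i * (16 * rdConstMax E i) ^ i

/-- The constants are nonnegative. [folklore] -/
theorem layerBound_nonneg (i : ℕ) : 0 ≤ layerBound E i := by
  unfold layerBound
  have := one_le_rdConstMax (E := E) i
  have := dyadicBumpBound'_nonneg i
  positivity

/-- **Scale-invariant derivative bounds for the layers**: `‖Dⁱ Λ_k(x)‖ ≤ C_i (2^k/ρ)^i` at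
every point off `K`.  At points where `2^k Δ/ρ ∉ [1/2, 2]` the layer vanishes identically
nearby; elsewhere `d ≥ Δ/8 ≥ ρ/(16 · 2^k)`, so `‖Dˡ (2^k Δ/ρ)‖ ≤ (2^k/ρ) R_l d^{1-l} ≤
(16 R* 2^k/ρ)^l`, and Mathlib's bound for the derivatives of a composition
(`norm_iteratedFDerivWithin_comp_le`) applies. [folklore] -/
theorem norm_iteratedFDeriv_layer_le {K : Set E} {ρ : ℝ} (hρ : 0 < ρ) (k i : ℕ) {x : E}
    (hx : 0 < infDist x K) :
    ‖iteratedFDeriv ℝ i (layer K ρ k) x‖ ≤ layerBound E i * (2 ^ k / ρ) ^ i := by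
  have hU : IsOpen (offSet K) := isOpen_offSet K
  have hxU : x ∈ offSet K := hx
  set a : ℝ := 2 ^ k / ρ with ha
  have h2k : (0 : ℝ) < 2 ^ k := by positivity
  have ha0 : 0 < a := by positivity
  have hR1 : 1 ≤ rdConstMax E i := one_le_rdConstMax i
  by_cases hact : ρ / 2 ≤ 2 ^ k * regDist K x ∧ 2 ^ k * regDist K x ≤ 2 * ρ
  · -- active region: `d ≥ ρ / (16 · 2^k)`, i.e. `16 a d ≥ 1`
    have hd : 1 ≤ 16 * a * infDist x K := by
      have h8 := regDist_le hx
      have h1 : ρ ≤ 16 * 2 ^ k * infDist x K := by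
        nlinarith [hact.1, mul_le_mul_of_nonneg_left h8 h2k.le]
      rw [ha]
      calc (1 : ℝ) = ρ / ρ := (div_self hρ.ne').symm
        _ ≤ (16 * 2 ^ k * infDist x K) / ρ := div_le_div_of_nonneg_right h1 hρ.le
        _ = 16 * (2 ^ k / ρ) * infDist x K := by ring
    have hf : ContDiffOn ℝ ∞ (a • regDist K) (offSet K) :=
      contDiffOn_const.smul (contDiffOn_regDist K)
    have hg : ContDiffOn ℝ ∞ dyadicBump univ := contDiff_dyadicBump.contDiffOn
    have hC : ∀ l, l ≤ i → ‖iteratedFDerivWithin ℝ l dyadicBump univ ((a • regDist K) x)‖ ≤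
        dyadicBumpBound' i := fun l hl => by
      rw [iteratedFDerivWithin_univ]
      exact norm_iteratedFDeriv_dyadicBump_le' hl _
    have hD : ∀ l, 1 ≤ l → l ≤ i →
        ‖iteratedFDerivWithin ℝ l (a • regDist K) (offSet K) x‖ ≤ (16 * rdConstMax E i * a) ^ l := by
      intro l hl1 hli
      obtain ⟨l, rfl⟩ : ∃ l', l = l' + 1 := ⟨l - 1, by omega⟩
      rw [iteratedFDerivWithin_const_smul_apply (((contDiffOn_regDist K) x hxU).of_le
        (by exact_mod_cast le_top))
        hU.uniqueDiffOn hxU, norm_smul, Real.norm_of_nonneg ha0.le,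
        iteratedFDerivWithin_of_isOpen (l + 1) hU hxU]
      have hb := norm_iteratedFDeriv_regDist_le (K := K) (i := l + 1) hl1 hx
      simp only [Nat.add_sub_cancel] at hb
      have hdpow : 0 < infDist x K ^ l := pow_pos hx l
      -- `R_{l+1} / d^l ≤ R* (16 a)^l`
      have hq : rdConst' E (l + 1) / infDist x K ^ l ≤ rdConstMax E i * (16 * a) ^ l := by
        rw [div_le_iff₀ hdpow]
        have h1 : (1 : ℝ) ≤ (16 * a * infDist x K) ^ l := one_le_pow₀ hd
        calc rdConst' E (l + 1) ≤ rdConstMax E i := rdConst'_le_rdConstMax hli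
          _ ≤ rdConstMax E i * (16 * a * infDist x K) ^ l :=
              le_mul_of_one_le_right (zero_le_one.trans hR1) h1
          _ = rdConstMax E i * (16 * a) ^ l * infDist x K ^ l := by rw [mul_pow]; ring
      calc a * ‖iteratedFDeriv ℝ (l + 1) (regDist K) x‖
          ≤ a * (rdConstMax E i * (16 * a) ^ l) :=
            mul_le_mul_of_nonneg_left (hb.trans hq) ha0.le
        _ = (rdConstMax E i * 16 ^ l) * a ^ (l + 1) := by ring
        _ ≤ (16 ^ (l + 1) * rdConstMax E i ^ (l + 1)) * a ^ (l + 1) := by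
            refine mul_le_mul_of_nonneg_right ?_ (by positivity)
            rw [mul_comm]
            exact mul_le_mul (pow_le_pow_right₀ (by norm_num) (Nat.le_succ l))
              (le_self_pow₀ hR1 (Nat.succ_ne_zero l)) (zero_le_one.trans hR1) (by positivity)
        _ = (16 * rdConstMax E i * a) ^ (l + 1) := by ring
    have key := norm_iteratedFDerivWithin_comp_le (n := i) (N := ∞) hg hf
      (by exact_mod_cast le_top) uniqueDiffOn_univ hU.uniqueDiffOn (mapsTo_univ _ _) hxU hC hD
    rw [← iteratedFDerivWithin_of_isOpen i hU hxU, layer_eq_comp]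
    calc ‖iteratedFDerivWithin ℝ i (dyadicBump ∘ (a • regDist K)) (offSet K) x‖
        ≤ i ! * dyadicBumpBound' i * (16 * rdConstMax E i * a) ^ i := key
      _ = layerBound E i * a ^ i := by rw [layerBound, mul_pow]; ring
  · -- inactive region: the layer vanishes identically near `x`
    have hev : layer K ρ k =ᶠ[𝓝 x] (0 : E → ℝ) := by
      have hc : ContinuousAt (fun y => 2 ^ k * regDist K y) x :=
        continuousAt_const.mul (continuousAt_regDist hx)
      rcases not_and_or.1 hact with h | h
      · have h' : 2 ^ k * regDist K x < ρ / 2 := lt_of_not_ge h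
        filter_upwards [hc.eventually (gt_mem_nhds h')] with y hy
        by_contra hne
        exact absurd (regDist_mem_of_layer_ne_zero hρ hne).1 (not_lt.2 hy.le)
      · have h' : 2 * ρ < 2 ^ k * regDist K x := lt_of_not_ge h
        filter_upwards [hc.eventually (lt_mem_nhds h')] with y hy
        by_contra hne
        exact absurd (regDist_mem_of_layer_ne_zero hρ hne).2 (not_lt.2 hy.le)
    rw [(hev.iteratedFDeriv ℝ i).eq_of_nhds, iteratedFDeriv_zero, Pi.zero_apply, norm_zero]
    exact mul_nonneg (layerBound_nonneg i) (by positivity)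

/-- The same bound for the derivatives *within* the open set `{d > 0}`. [folklore] -/
theorem norm_iteratedFDerivWithin_layer_le {K : Set E} {ρ : ℝ} (hρ : 0 < ρ) (k i : ℕ) {x : E}
    (hx : 0 < infDist x K) :
    ‖iteratedFDerivWithin ℝ i (layer K ρ k) (offSet K) x‖ ≤ layerBound E i * (2 ^ k / ρ) ^ i := by
  rw [iteratedFDerivWithin_of_isOpen i (isOpen_offSet K) hx]
  exact norm_iteratedFDeriv_layer_le hρ k i hx

end Layers

end Literature.Analysis.Calculus.WhitneyConvex
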